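import Mathlib
import Literature.NumberTheory.Automorphic.HilbertModularFormQExpansion
import Summits.Langlands.Langlands.Theorems.CapacityClassicalityHilbertIntegralOverconvergentIsCongruenceStubTraceEncodingInjective
import Summits.Langlands.Langlands.Theorems.CapacityClassicalityHilbertIntegralOverconvergentIsCongruenceStubTracePosOfTotallyPositive
import Summits.Langlands.Langlands.Theorems.CapacityClassicalityHilbertIntegralOverconvergentIsCongruenceStubTotallyPositiveIntegralBasis

/-!
# Encoding the cone of Hilbert `q`-expansion indices into `ℕ^d`

Stub `stub_qIndex_encoding` (O3) for line Sketch-ideate-r1-k1 of the crux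
`HilbertIntegralOverconvergentIsCongruence` (stmt-Langlands-8485).  The `q`-expansions of Hilbert
modular forms over a totally real field `F` of degree `d` are indexed by the cone `qIndexSet F` of
elements of the dual lattice `𝔡⁻¹` that are `0` or totally positive; the line's algebraization
engine works with `MvPowerSeries (Fin d)`, so the cone has to be moved into `ℕ^d = Fin d →₀ ℕ`
additively and injectively.  Encoding: `ν ↦ (Tr_{F/ℚ}(β_j ν))_j` for a `ℚ`-basis `β` of `F`
consisting of totally positive algebraic integers (landed `stub_exists_totallyPositive_integralBasis`).
On the cone each `Tr(β_j ν)` is an integer (`ν ∈ 𝔡⁻¹`, `β_j ∈ 𝓞 F`) and is `≥ 0` (landed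
`stub_tracePosOfTotallyPositive`), so it is recovered from `⌊Tr(β_j ν)⌋.toNat`; additivity is
additivity of the trace (the cone is closed under addition), and injectivity is the landed
`stub_traceEncodingInjective` (non-degeneracy of the trace form).
-/

set_option linter.dupNamespace false

noncomputable section

namespace Summit.Langlands.Langlands.Theorems.HilbertIntegralOverconvergentIsCongruence

open NumberField
open Literature.NumberTheory.Automorphic Literature.NumberTheory.Automorphic.HilbertModular

/-- A rational number which is a nonnegative integer is recovered from `⌊q⌋.toNat`. -/
theorem enc_cast_toNat_floor {q : ℚ} {n : ℤ} (hq : q = n) (h0 : 0 ≤ q) :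
    ((⌊q⌋.toNat : ℕ) : ℚ) = q := by
  subst hq
  have hn : 0 ≤ n := by exact_mod_cast h0
  rw [Int.floor_intCast, ← Int.cast_natCast, Int.toNat_of_nonneg hn]

/-- The cone `qIndexSet F` of `q`-expansion indices is closed under addition. -/
theorem enc_add_mem_qIndexSet (F : Type*) [Field F] [NumberField F] {μ μ' : F}
    (hμ : μ ∈ qIndexSet F) (hμ' : μ' ∈ qIndexSet F) : μ + μ' ∈ qIndexSet F := by
  refine ⟨fun a ↦ ?_, ?_⟩
  · obtain ⟨n, hn⟩ := hμ.1 a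
    obtain ⟨n', hn'⟩ := hμ'.1 a
    exact ⟨n + n', by rw [add_mul, map_add, hn, hn', Int.cast_add]⟩
  · rcases hμ.2 with h | h
    · rw [h, zero_add]
      exact hμ'.2
    · rcases hμ'.2 with h' | h'
      · rw [h', add_zero]
        exact Or.inr h
      · exact Or.inr fun σ ↦ by rw [map_add]; exact add_pos (h σ) (h' σ)

/-- On the cone, the trace against a totally positive algebraic integer `b` is a nonnegative
integer, hence is recovered (as a rational number) from `⌊Tr(b ν)⌋.toNat`. -/
theorem enc_cast_idx (F : Type*) [Field F] [NumberField F] [NumberField.IsTotallyReal F] {μ : F}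
    (hμ : μ ∈ qIndexSet F) (b : 𝓞 F) (hb : ∀ τ : F →+* ℝ, 0 < τ b) :
    ((⌊Algebra.trace ℚ F ((b : F) * μ)⌋.toNat : ℕ) : ℚ) = Algebra.trace ℚ F ((b : F) * μ) := by
  obtain ⟨n, hn⟩ := hμ.1 b
  rw [mul_comm] at hn
  refine enc_cast_toNat_floor hn ?_
  rcases hμ.2 with h0 | hpos
  · rw [h0, mul_zero, map_zero]
  · exact (stub_tracePosOfTotallyPositive F (b : F) μ hb hpos).le

/-- **stub O3 — `stub_qIndex_encoding`.** The exponents of Hilbert `q`-expansions embed additively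
and injectively into `ℕ^d`, `d = [F:ℚ]`: `ν ↦ (Tr(β_j ν))_j` for a `ℚ`-basis `β` of totally
positive algebraic integers (landed S13a, S10a, S10b). [folklore] -/
theorem stub_qIndex_encoding (F : Type) [Field F] [NumberField F] [NumberField.IsTotallyReal F] :
    ∃ (d : ℕ) (idx : F → (Fin d →₀ ℕ)), Set.InjOn idx (qIndexSet F) ∧
      ∀ μ ∈ qIndexSet F, ∀ μ' ∈ qIndexSet F, idx (μ + μ') = idx μ + idx μ' := by
  classical
  obtain ⟨β, hli, hpos⟩ := stub_exists_totallyPositive_integralBasis F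
  refine ⟨Module.finrank ℚ F, fun μ ↦ Finsupp.equivFunOnFinite.symm
    fun j ↦ ⌊Algebra.trace ℚ F ((β j : F) * μ)⌋.toNat, ?_, ?_⟩
  · -- injectivity on the cone: equal encodings give equal rational trace vectors
    intro μ hμ μ' hμ' h
    refine stub_traceEncodingInjective F (fun j ↦ (β j : F)) hli rfl (funext fun j ↦ ?_)
    have hj := congrArg (fun f : Fin (Module.finrank ℚ F) →₀ ℕ ↦ ((f j : ℕ) : ℚ)) h
    simp only [Finsupp.coe_equivFunOnFinite_symm] at hj
    rwa [enc_cast_idx F hμ (β j) (hpos j), enc_cast_idx F hμ' (β j) (hpos j)] at hj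
  · -- additivity on the cone: additivity of the trace
    intro μ hμ μ' hμ'
    ext j
    apply Nat.cast_injective (R := ℚ)
    simp only [Finsupp.add_apply, Finsupp.coe_equivFunOnFinite_symm, Nat.cast_add]
    rw [enc_cast_idx F hμ (β j) (hpos j), enc_cast_idx F hμ' (β j) (hpos j),
      enc_cast_idx F (enc_add_mem_qIndexSet F hμ hμ') (β j) (hpos j), mul_add, map_add]

end Summit.Langlands.Langlands.Theorems.HilbertIntegralOverconvergentIsCongruence

end
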